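import Mathlib
import Summits.ValiantsHypothesis.ValiantsHypothesis.Theorems.LacunarySymmetroidMatrixDescartesMonotoneFlagEnds

/-!
# `MatrixDescartes` (stmt-ValiantsHypothesis-18050) — END INERTIAS OF THE UNIVERSAL TWO-SIDED WORD WITH A DEGENERATE PIVOT:
# `ν(S₀|W_U) ≤ ν(F(∞)) ≤ ν̄(S₀|W_U)` and `ν(S₀|W_L) ≤ ν(F(0⁺)) ≤ ν̄(S₀|W_L)` (PSD letters on BOTH sides, no invertibility anywhere)

HONEST FRAMING.  Cell `pub-symmetroid`, seat `val-sym-mdr-p2` (gen 22); helper file `--supports` the crux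
`Theses.LacunarySymmetroid.MatrixDescartes` (OPEN), NO closure claim.  STRUCTURE theorems for the crux's universal word (line `Lift`,
`stub_twoSided`: `X^e J + Σ X^{d_k}P_k` with `P_k ⪰ 0` on BOTH sides of the pivot; here in the crux currency with the pivot as a
letter): the END INERTIAS are pinned, up to the kernel of a compression of the pivot, by letter data alone.  Companion of `…MonotoneFlagEnds`
(monotone sector, where the two ends are EXACT); same engine (`GramDual.eventually_pos_family_oneRate`, the one-rate core lemma).  Nothing
here bears on the crux in its window, `stub_twoSided`, `DoorA26` / `DoorA34`, registers, or `VP ≠ VNP`; these are END data (drift, parity),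
not a root ceiling.

SETTING.  Real symmetric letters `S l`, exponents `d l`, pivot `l₀`, `S₀ := S l₀` ARBITRARY; every other letter PSD with `d l ≠ d l₀`
(UPPER if `d l > d l₀`, LOWER if `d l < d l₀`).  `W_U = ⋂_upper ker S l`, `W_L = ⋂_lower ker S l`; `B_U : ι × α` injective with
`S l · B_U = 0` (upper `l`), FULL if its range contains `W_U`; `C_U = B_Uᵀ S₀ B_U`; likewise `B_L`, `C_L`.

* `univ_form_ge_large` / `univ_form_le_large_of_kernel` / `univ_form_ge_small` / `univ_form_le_small_of_kernel` — one-rate comparisons: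
  for `x ≥ 1`, `vᵀF(x)v ≥ x^{d₀}(vᵀS₀v + x·vᵀP_Uv)` (`P_U = Σ_upper S l`) and, for `v` killed by the upper letters,
  `vᵀF(x)v ≤ x^{d₀}(vᵀS₀v + x⁻¹·vᵀN_Lv)` (`N_L = Σ_lower S l`); mirror statements for `x ≤ 1`.
* **`univ_eventually_negIndex_le_large`** — full `B_U`: `ν(F(x)) + π(C_U) ≤ dim W_U` for large `x` (positive family «λ⁺(P_U)» ⊔ «B_U·λ⁺(C_U)»).
* **`univ_eventually_negIndex_ge_large`** — any `B_U` killed by the upper letters: `ν(C_U) ≤ ν(F(x))` for large `x` (negative family «B_U·λ⁻(C_U)», core lemma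
  for `(0, −C_U, B_Uᵀ N_L B_U)`).
* **`univ_eventually_negIndex_le_small`**, **`univ_eventually_negIndex_ge_small`** — the mirror statements at `0⁺` with `C_L`.
So `ν(F(∞)) ∈ [ν(S₀|W_U), dim W_U − π(S₀|W_U)]` and `ν(F(0⁺)) ∈ [ν(S₀|W_L), dim W_L − π(S₀|W_L)]`: the end inertias of the universal
word are determined by the pivot's compressions up to the KERNEL DIMENSION of the compression (exactly when the compression is
non-singular — the pivot itself may be singular).  On the monotone sector the lower letters are NSD and the two intervals collapse to their
upper, resp. lower, ends (`…MonotoneFlagEnds`); for PSD lower letters the kernel directions of `S₀|W_U` are decided by the exponent GAPS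
(predecessor memo MONOTONE-EXACT §4 (L1)), so the interval is the honest statement.  Drift / parity consequences: `…UniversalWordDrift`.

[folklore] (Sylvester's law of inertia in family language; persistence).  Axioms `propext`, `Classical.choice`, `Quot.sound`.  No definitions.
-/

-- layout Summits/ValiantsHypothesis/ValiantsHypothesis forces the duplicated namespace component
set_option linter.dupNamespace false

namespace Summit.ValiantsHypothesis.ValiantsHypothesis.Theorems.LacunarySymmetroidMatrixDescartes

open Polynomial Matrix Finset
open scoped BigOperators

namespace GramDual

section UniversalEnds

variable {ι κ : Type} [Fintype ι] [DecidableEq ι] [Fintype κ] [DecidableEq κ]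

omit [DecidableEq ι] [DecidableEq κ] in
/-- Quadratic form of the evaluated pencil as a sum over letters. [folklore] -/
theorem form_pencil_eval (d : κ → ℕ) (S : κ → Matrix ι ι ℝ) (x : ℝ) (v : ι → ℝ) :
    v ⬝ᵥ ((∑ l, x ^ d l • S l) *ᵥ v) = ∑ l, x ^ d l * (v ⬝ᵥ (S l *ᵥ v)) := by
  simp only [Matrix.sum_mulVec, dotProduct_sum, Matrix.smul_mulVec, dotProduct_smul, smul_eq_mul]

omit [DecidableEq ι] in
/-- **Comparison at large scales**: PSD non-pivot letters, `x ≥ 1` ⇒ `vᵀF(x)v ≥ x^{d₀}(vᵀS₀v + x·vᵀP_Uv)`, `P_U = Σ_upper S l`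
(drop the lower letters, `x^{d_l} ≥ x^{d₀+1}` on the upper ones). [folklore] -/
theorem univ_form_ge_large (d : κ → ℕ) (S : κ → Matrix ι ι ℝ) (l₀ : κ) (hpsd : ∀ l, l ≠ l₀ → (S l).PosSemidef)
    (hd : ∀ l, l ≠ l₀ → d l ≠ d l₀) {x : ℝ} (hx1 : 1 ≤ x) (v : ι → ℝ) :
    x ^ d l₀ * (v ⬝ᵥ (S l₀ *ᵥ v) + x * (v ⬝ᵥ ((∑ l ∈ Finset.univ.filter (fun l => d l₀ < d l), S l) *ᵥ v)))
      ≤ v ⬝ᵥ ((∑ l, x ^ d l • S l) *ᵥ v) := by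
  classical
  have hd' : ∀ l, l ≠ l₀ → d l₀ < d l ∨ d l < d l₀ := fun l hl => (lt_or_gt_of_ne (hd l hl)).symm.imp id id
  rw [form_pencil_eval, sum_letters_split d l₀ hd']
  simp only [Matrix.sum_mulVec, dotProduct_sum, Finset.mul_sum, mul_add]
  have hq : ∀ l, l ≠ l₀ → 0 ≤ v ⬝ᵥ (S l *ᵥ v) := fun l hl => by
    simpa only [star_trivial] using (hpsd l hl).dotProduct_mulVec_nonneg v
  have hup : ∀ l ∈ Finset.univ.filter (fun l => d l₀ < d l),
      x ^ d l₀ * (x * (v ⬝ᵥ (S l *ᵥ v))) ≤ x ^ d l * (v ⬝ᵥ (S l *ᵥ v)) := by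
    intro l hl
    have hdl := (Finset.mem_filter.1 hl).2
    have hl0 : l ≠ l₀ := fun h => by rw [h] at hdl; exact lt_irrefl _ hdl
    rw [← mul_assoc, ← pow_succ]
    exact mul_le_mul_of_nonneg_right (pow_le_pow_right₀ hx1 (by omega)) (hq l hl0)
  have hlow : ∀ l ∈ Finset.univ.filter (fun l => d l < d l₀), 0 ≤ x ^ d l * (v ⬝ᵥ (S l *ᵥ v)) := by
    intro l hl
    have hdl := (Finset.mem_filter.1 hl).2
    have hl0 : l ≠ l₀ := fun h => by rw [h] at hdl; exact lt_irrefl _ hdl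
    exact mul_nonneg (pow_nonneg (by linarith) _) (hq l hl0)
  have h1 := Finset.sum_le_sum hup
  have h2 := Finset.sum_nonneg hlow
  linarith

omit [DecidableEq ι] in
/-- **Comparison at large scales on the upper joint kernel**: for `v` killed by every upper letter and `x ≥ 1`,
`vᵀF(x)v ≤ x^{d₀}(vᵀS₀v + x⁻¹·vᵀN_Lv)`, `N_L = Σ_lower S l` (`x^{d_l} ≤ x^{d₀−1}` on the lower letters). [folklore] -/
theorem univ_form_le_large_of_kernel (d : κ → ℕ) (S : κ → Matrix ι ι ℝ) (l₀ : κ) (hpsd : ∀ l, l ≠ l₀ → (S l).PosSemidef)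
    (hd : ∀ l, l ≠ l₀ → d l ≠ d l₀) {x : ℝ} (hx1 : 1 ≤ x) (v : ι → ℝ) (hv : ∀ l, d l₀ < d l → S l *ᵥ v = 0) :
    v ⬝ᵥ ((∑ l, x ^ d l • S l) *ᵥ v)
      ≤ x ^ d l₀ * (v ⬝ᵥ (S l₀ *ᵥ v) + x⁻¹ * (v ⬝ᵥ ((∑ l ∈ Finset.univ.filter (fun l => d l < d l₀), S l) *ᵥ v))) := by
  classical
  have hxpos : 0 < x := by linarith
  have hd' : ∀ l, l ≠ l₀ → d l₀ < d l ∨ d l < d l₀ := fun l hl => (lt_or_gt_of_ne (hd l hl)).symm.imp id id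
  rw [form_pencil_eval, sum_letters_split d l₀ hd']
  simp only [Matrix.sum_mulVec, dotProduct_sum, Finset.mul_sum, mul_add]
  have hq : ∀ l, l ≠ l₀ → 0 ≤ v ⬝ᵥ (S l *ᵥ v) := fun l hl => by
    simpa only [star_trivial] using (hpsd l hl).dotProduct_mulVec_nonneg v
  have hup : ∑ l ∈ Finset.univ.filter (fun l => d l₀ < d l), x ^ d l * (v ⬝ᵥ (S l *ᵥ v)) = 0 :=
    Finset.sum_eq_zero fun l hl => by rw [hv l (Finset.mem_filter.1 hl).2, dotProduct_zero, mul_zero]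
  have hlow : ∀ l ∈ Finset.univ.filter (fun l => d l < d l₀),
      x ^ d l * (v ⬝ᵥ (S l *ᵥ v)) ≤ x ^ d l₀ * (x⁻¹ * (v ⬝ᵥ (S l *ᵥ v))) := by
    intro l hl
    have hdl := (Finset.mem_filter.1 hl).2
    have hl0 : l ≠ l₀ := fun h => by rw [h] at hdl; exact lt_irrefl _ hdl
    rw [← mul_assoc]
    refine mul_le_mul_of_nonneg_right ?_ (hq l hl0)
    rw [le_mul_inv_iff₀ hxpos, ← pow_succ]
    exact pow_le_pow_right₀ hx1 (by omega)
  have h2 := Finset.sum_le_sum hlow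
  linarith

omit [DecidableEq ι] in
/-- **Comparison at small scales**: PSD non-pivot letters, `0 < x ≤ 1` ⇒ `vᵀF(x)v ≥ x^{d₀}(vᵀS₀v + x⁻¹·vᵀN_Lv)`. [folklore] -/
theorem univ_form_ge_small (d : κ → ℕ) (S : κ → Matrix ι ι ℝ) (l₀ : κ) (hpsd : ∀ l, l ≠ l₀ → (S l).PosSemidef)
    (hd : ∀ l, l ≠ l₀ → d l ≠ d l₀) {x : ℝ} (hxpos : 0 < x) (hx1 : x ≤ 1) (v : ι → ℝ) :
    x ^ d l₀ * (v ⬝ᵥ (S l₀ *ᵥ v) + x⁻¹ * (v ⬝ᵥ ((∑ l ∈ Finset.univ.filter (fun l => d l < d l₀), S l) *ᵥ v)))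
      ≤ v ⬝ᵥ ((∑ l, x ^ d l • S l) *ᵥ v) := by
  classical
  have hd' : ∀ l, l ≠ l₀ → d l₀ < d l ∨ d l < d l₀ := fun l hl => (lt_or_gt_of_ne (hd l hl)).symm.imp id id
  rw [form_pencil_eval, sum_letters_split d l₀ hd']
  simp only [Matrix.sum_mulVec, dotProduct_sum, Finset.mul_sum, mul_add]
  have hq : ∀ l, l ≠ l₀ → 0 ≤ v ⬝ᵥ (S l *ᵥ v) := fun l hl => by
    simpa only [star_trivial] using (hpsd l hl).dotProduct_mulVec_nonneg v
  have hlow : ∀ l ∈ Finset.univ.filter (fun l => d l < d l₀),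
      x ^ d l₀ * (x⁻¹ * (v ⬝ᵥ (S l *ᵥ v))) ≤ x ^ d l * (v ⬝ᵥ (S l *ᵥ v)) := by
    intro l hl
    have hdl := (Finset.mem_filter.1 hl).2
    have hl0 : l ≠ l₀ := fun h => by rw [h] at hdl; exact lt_irrefl _ hdl
    rw [← mul_assoc]
    refine mul_le_mul_of_nonneg_right ?_ (hq l hl0)
    rw [mul_inv_le_iff₀ hxpos, ← pow_succ]
    exact pow_le_pow_of_le_one hxpos.le hx1 (by omega)
  have hup : ∀ l ∈ Finset.univ.filter (fun l => d l₀ < d l), 0 ≤ x ^ d l * (v ⬝ᵥ (S l *ᵥ v)) := by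
    intro l hl
    have hdl := (Finset.mem_filter.1 hl).2
    have hl0 : l ≠ l₀ := fun h => by rw [h] at hdl; exact lt_irrefl _ hdl
    exact mul_nonneg (pow_nonneg hxpos.le _) (hq l hl0)
  have h1 := Finset.sum_le_sum hlow
  have h2 := Finset.sum_nonneg hup
  linarith

omit [DecidableEq ι] in
/-- **Comparison at small scales on the lower joint kernel**: for `v` killed by every lower letter and `0 < x ≤ 1`,
`vᵀF(x)v ≤ x^{d₀}(vᵀS₀v + x·vᵀP_Uv)`. [folklore] -/
theorem univ_form_le_small_of_kernel (d : κ → ℕ) (S : κ → Matrix ι ι ℝ) (l₀ : κ) (hpsd : ∀ l, l ≠ l₀ → (S l).PosSemidef)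
    (hd : ∀ l, l ≠ l₀ → d l ≠ d l₀) {x : ℝ} (hxpos : 0 < x) (hx1 : x ≤ 1) (v : ι → ℝ) (hv : ∀ l, d l < d l₀ → S l *ᵥ v = 0) :
    v ⬝ᵥ ((∑ l, x ^ d l • S l) *ᵥ v)
      ≤ x ^ d l₀ * (v ⬝ᵥ (S l₀ *ᵥ v) + x * (v ⬝ᵥ ((∑ l ∈ Finset.univ.filter (fun l => d l₀ < d l), S l) *ᵥ v))) := by
  classical
  have hd' : ∀ l, l ≠ l₀ → d l₀ < d l ∨ d l < d l₀ := fun l hl => (lt_or_gt_of_ne (hd l hl)).symm.imp id id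
  rw [form_pencil_eval, sum_letters_split d l₀ hd']
  simp only [Matrix.sum_mulVec, dotProduct_sum, Finset.mul_sum, mul_add]
  have hq : ∀ l, l ≠ l₀ → 0 ≤ v ⬝ᵥ (S l *ᵥ v) := fun l hl => by
    simpa only [star_trivial] using (hpsd l hl).dotProduct_mulVec_nonneg v
  have hlow : ∑ l ∈ Finset.univ.filter (fun l => d l < d l₀), x ^ d l * (v ⬝ᵥ (S l *ᵥ v)) = 0 :=
    Finset.sum_eq_zero fun l hl => by rw [hv l (Finset.mem_filter.1 hl).2, dotProduct_zero, mul_zero]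
  have hup : ∀ l ∈ Finset.univ.filter (fun l => d l₀ < d l),
      x ^ d l * (v ⬝ᵥ (S l *ᵥ v)) ≤ x ^ d l₀ * (x * (v ⬝ᵥ (S l *ᵥ v))) := by
    intro l hl
    have hdl := (Finset.mem_filter.1 hl).2
    have hl0 : l ≠ l₀ := fun h => by rw [h] at hdl; exact lt_irrefl _ hdl
    rw [← mul_assoc, ← pow_succ]
    exact mul_le_mul_of_nonneg_right (pow_le_pow_of_le_one hxpos.le hx1 (by omega)) (hq l hl0)
  have h1 := Finset.sum_le_sum hup
  linarith

omit [DecidableEq ι] [DecidableEq κ] in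
/-- PSD-ness and kernel of the sum of the upper (or lower) letters. [folklore] -/
theorem posSemidef_sum_filter (S : κ → Matrix ι ι ℝ) (l₀ : κ) (hpsd : ∀ l, l ≠ l₀ → (S l).PosSemidef)
    (p : κ → Prop) [DecidablePred p] (hp : ¬ p l₀) :
    (∑ l ∈ Finset.univ.filter p, S l).PosSemidef ∧
      ∀ v : ι → ℝ, (∑ l ∈ Finset.univ.filter p, S l) *ᵥ v = 0 → ∀ l, p l → S l *ᵥ v = 0 := by
  classical
  have hpsd' : ∀ l ∈ Finset.univ.filter p, (S l).PosSemidef := fun l hl => by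
    have hl := (Finset.mem_filter.1 hl).2
    exact hpsd l fun h => hp (h ▸ hl)
  refine ⟨Matrix.posSemidef_sum _ hpsd', fun v hv l hl => ?_⟩
  have hsum : ∑ l ∈ Finset.univ.filter p, v ⬝ᵥ (S l *ᵥ v) = 0 := by
    have h := congrArg (fun w => v ⬝ᵥ w) hv
    simp only [Matrix.sum_mulVec, dotProduct_sum, dotProduct_zero] at h
    exact h
  have hnn : ∀ l ∈ Finset.univ.filter p, 0 ≤ v ⬝ᵥ (S l *ᵥ v) := fun l hl => by
    simpa only [star_trivial] using (hpsd' l hl).dotProduct_mulVec_nonneg v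
  have h0 := (Finset.sum_eq_zero_iff_of_nonneg hnn).1 hsum l (Finset.mem_filter.2 ⟨Finset.mem_univ _, hl⟩)
  exact mulVec_eq_zero_of_form_eq_zero (hpsd' l (Finset.mem_filter.2 ⟨Finset.mem_univ _, hl⟩)) v h0

/-- **UPPER END, upper bound.**  Full basis `B_U` of `W_U` ⇒ `ν(F(x)) + π(C_U) ≤ card α` for all large `x`. [folklore] -/
theorem univ_eventually_negIndex_le_large (d : κ → ℕ) (S : κ → Matrix ι ι ℝ) (hS : ∀ l, (S l).IsSymm) (l₀ : κ)
    (hpsd : ∀ l, l ≠ l₀ → (S l).PosSemidef) (hd : ∀ l, l ≠ l₀ → d l ≠ d l₀)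
    {α : Type} [Fintype α] [DecidableEq α] (BU : Matrix ι α ℝ) (hBU : ∀ l, d l₀ < d l → S l * BU = 0)
    (hBUspan : ∀ v : ι → ℝ, (∀ l, d l₀ < d l → S l *ᵥ v = 0) → ∃ c : α → ℝ, BU *ᵥ c = v)
    (hCU : (BUᵀ * S l₀ * BU).IsHermitian) :
    ∃ X : ℝ, 0 < X ∧ ∀ x : ℝ, X ≤ x →
      Fintype.card {j // (Inertia.isHermitian_pencil d S hS x).eigenvalues j < 0}
        + Fintype.card {j // 0 < hCU.eigenvalues j} ≤ Fintype.card α := by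
  classical
  set P : Matrix ι ι ℝ := ∑ l ∈ Finset.univ.filter (fun l => d l₀ < d l), S l with hPdef
  obtain ⟨hPpsd, hPker⟩ := posSemidef_sum_filter S l₀ hpsd (fun l => d l₀ < d l) (lt_irrefl _)
  have hPh : P.IsHermitian := hPpsd.1
  have hPB : P * BU = 0 := by
    rw [hPdef, Matrix.sum_mul]
    exact Finset.sum_eq_zero fun l hl => hBU l (Finset.mem_filter.1 hl).2
  obtain ⟨Y, hY, hfam⟩ := eventually_pos_family_oneRate P (S l₀) 0 hPh BU hPB hCU
  refine ⟨max Y 1, lt_max_of_lt_left hY, fun x hx => ?_⟩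
  have hxY : Y ≤ x := le_trans (le_max_left _ _) hx
  have hx1 : 1 ≤ x := le_trans (le_max_right _ _) hx
  have hxpos : 0 < x := by linarith
  set hF := Inertia.isHermitian_pencil d S hS x
  have hposF : ∀ c : ({i // 0 < hPh.eigenvalues i} ⊕ {j // 0 < hCU.eigenvalues j}) → ℝ, c ≠ 0 →
      0 < (∑ k, c k • Sum.elim (fun i : {i // 0 < hPh.eigenvalues i} => (hPh.eigenvectorBasis i.1).ofLp)
            (fun j : {j // 0 < hCU.eigenvalues j} => BU *ᵥ (hCU.eigenvectorBasis j.1).ofLp) k) ⬝ᵥ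
          ((∑ l, x ^ d l • S l) *ᵥ ∑ k, c k • Sum.elim (fun i : {i // 0 < hPh.eigenvalues i} => (hPh.eigenvectorBasis i.1).ofLp)
            (fun j : {j // 0 < hCU.eigenvalues j} => BU *ᵥ (hCU.eigenvectorBasis j.1).ofLp) k) := by
    intro c hc
    have h := hfam x hxY c hc
    rw [smul_zero, sub_zero] at h
    have hcmp := univ_form_ge_large d S l₀ hpsd hd hx1
      (∑ k, c k • Sum.elim (fun i : {i // 0 < hPh.eigenvalues i} => (hPh.eigenvectorBasis i.1).ofLp)
        (fun j : {j // 0 < hCU.eigenvalues j} => BU *ᵥ (hCU.eigenvectorBasis j.1).ofLp) k)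
    have hform : ∀ v : ι → ℝ, v ⬝ᵥ ((x • P + S l₀) *ᵥ v) = v ⬝ᵥ (S l₀ *ᵥ v) + x * (v ⬝ᵥ (P *ᵥ v)) := by
      intro v
      simp only [Matrix.add_mulVec, Matrix.smul_mulVec, dotProduct_add, dotProduct_smul, smul_eq_mul]
      ring
    rw [hform] at h
    exact lt_of_lt_of_le (mul_pos (pow_pos hxpos _) h) hcmp
  have hcount := Inertia.card_le_posIndex hF _ hposF
  rw [Fintype.card_sum] at hcount
  have hidx := (Inertia.negIndex_add_posIndex_add_corank hF).1
  have hspan := card_le_posIndex_add_card_of_ker_subset_range hPpsd hPh BU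
    (fun v hv => hBUspan v (hPker v hv))
  omega

/-- **UPPER END, lower bound.**  Any `B_U` killed by the upper letters ⇒ `ν(C_U) ≤ ν(F(x))` for all large `x` (the negative
eigenvectors of `C_U`, pushed by `B_U`, stay negative: the lower letters only add `O(x^{d₀−1})`). [folklore] -/
theorem univ_eventually_negIndex_ge_large (d : κ → ℕ) (S : κ → Matrix ι ι ℝ) (hS : ∀ l, (S l).IsSymm) (l₀ : κ)
    (hpsd : ∀ l, l ≠ l₀ → (S l).PosSemidef) (hd : ∀ l, l ≠ l₀ → d l ≠ d l₀)
    {α : Type} [Fintype α] [DecidableEq α] (BU : Matrix ι α ℝ) (hBU : ∀ l, d l₀ < d l → S l * BU = 0)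
    (hCU : (BUᵀ * S l₀ * BU).IsHermitian) :
    ∃ X : ℝ, 0 < X ∧ ∀ x : ℝ, X ≤ x →
      Fintype.card {j // hCU.eigenvalues j < 0}
        ≤ Fintype.card {j // (Inertia.isHermitian_pencil d S hS x).eigenvalues j < 0} := by
  classical
  set NL : Matrix ι ι ℝ := ∑ l ∈ Finset.univ.filter (fun l => d l < d l₀), S l with hNLdef
  -- core lemma on the coefficient space `α` for the triple `(0, −C_U, B_Uᵀ N_L B_U)` with basis `1`
  have h0h : (0 : Matrix α α ℝ).IsHermitian := Matrix.isHermitian_zero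
  have hCn : (-(BUᵀ * S l₀ * BU)).IsHermitian := hCU.neg
  have hC1 : ((1 : Matrix α α ℝ)ᵀ * (-(BUᵀ * S l₀ * BU)) * 1).IsHermitian := by
    rw [Matrix.transpose_one, Matrix.one_mul, Matrix.mul_one]; exact hCn
  obtain ⟨Y, hY, hfam⟩ := eventually_pos_family_oneRate (0 : Matrix α α ℝ) (-(BUᵀ * S l₀ * BU)) (BUᵀ * NL * BU) h0h 1
    (Matrix.zero_mul _) hC1
  refine ⟨max Y 1, lt_max_of_lt_left hY, fun x hx => ?_⟩
  have hxY : Y ≤ x := le_trans (le_max_left _ _) hx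
  have hx1 : 1 ≤ x := le_trans (le_max_right _ _) hx
  have hxpos : 0 < x := by linarith
  set hF := Inertia.isHermitian_pencil d S hS x
  -- the `ι`-family `B_U · (family of the core lemma)` is negative for `F(x)`
  set fam := fun k : ({i // 0 < h0h.eigenvalues i} ⊕ {j // 0 < hC1.eigenvalues j}) =>
    Sum.elim (fun i : {i // 0 < h0h.eigenvalues i} => (h0h.eigenvectorBasis i.1).ofLp)
      (fun j : {j // 0 < hC1.eigenvalues j} => (1 : Matrix α α ℝ) *ᵥ (hC1.eigenvectorBasis j.1).ofLp) k with hfamdef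
  have hnegF : ∀ c : ({i // 0 < h0h.eigenvalues i} ⊕ {j // 0 < hC1.eigenvalues j}) → ℝ, c ≠ 0 →
      (∑ k, c k • (BU *ᵥ fam k)) ⬝ᵥ ((∑ l, x ^ d l • S l) *ᵥ ∑ k, c k • (BU *ᵥ fam k)) < 0 := by
    intro c hc
    have h := hfam x hxY c hc
    set z : α → ℝ := ∑ k, c k • fam k with hz
    have hcomb : ∑ k, c k • (BU *ᵥ fam k) = BU *ᵥ z := by rw [hz]; exact sum_smul_mulVec BU _ c
    rw [hcomb]
    have hker : ∀ l, d l₀ < d l → S l *ᵥ (BU *ᵥ z) = 0 := fun l hl => by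
      rw [Matrix.mulVec_mulVec, hBU l hl, Matrix.zero_mulVec]
    have hcmp := univ_form_le_large_of_kernel d S l₀ hpsd hd hx1 (BU *ᵥ z) hker
    have hform : z ⬝ᵥ ((x • (0 : Matrix α α ℝ) + -(BUᵀ * S l₀ * BU) - x⁻¹ • (BUᵀ * NL * BU)) *ᵥ z)
        = -((BU *ᵥ z) ⬝ᵥ (S l₀ *ᵥ (BU *ᵥ z)) + x⁻¹ * ((BU *ᵥ z) ⬝ᵥ (NL *ᵥ (BU *ᵥ z)))) := by
      rw [form_mulVec_eq (S l₀) BU z, form_mulVec_eq NL BU z]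
      simp only [smul_zero, zero_add, Matrix.sub_mulVec, Matrix.neg_mulVec, Matrix.smul_mulVec, dotProduct_sub,
        dotProduct_neg, dotProduct_smul, smul_eq_mul]
      ring
    rw [hform] at h
    have hneg : (BU *ᵥ z) ⬝ᵥ (S l₀ *ᵥ (BU *ᵥ z)) + x⁻¹ * ((BU *ᵥ z) ⬝ᵥ (NL *ᵥ (BU *ᵥ z))) < 0 := by linarith
    exact lt_of_le_of_lt hcmp (mul_neg_of_pos_of_neg (pow_pos hxpos _) hneg)
  have hcount := Inertia.card_le_negIndex hF _ hnegF
  rw [Fintype.card_sum] at hcount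
  -- `π(−C_U) = ν(C_U)`
  have hπ : Fintype.card {j // 0 < hC1.eigenvalues j} = Fintype.card {j // hCU.eigenvalues j < 0} := by
    rw [Inertia.posIndex_congr hC1 hCn (by rw [Matrix.transpose_one, Matrix.one_mul, Matrix.mul_one])]
    have hCnn : (-(-(BUᵀ * S l₀ * BU))).IsHermitian := hCn.neg
    have h1 := negIndex_neg_eq_posIndex hCn hCnn
    rw [Inertia.negIndex_congr hCnn hCU (neg_neg _)] at h1
    exact h1.symm
  omega

/-- **LOWER END, upper bound.**  Full basis `B_L` of `W_L` ⇒ `ν(F(x)) + π(C_L) ≤ card β` for all small `x > 0`. [folklore] -/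
theorem univ_eventually_negIndex_le_small (d : κ → ℕ) (S : κ → Matrix ι ι ℝ) (hS : ∀ l, (S l).IsSymm) (l₀ : κ)
    (hpsd : ∀ l, l ≠ l₀ → (S l).PosSemidef) (hd : ∀ l, l ≠ l₀ → d l ≠ d l₀)
    {β : Type} [Fintype β] [DecidableEq β] (BL : Matrix ι β ℝ) (hBL : ∀ l, d l < d l₀ → S l * BL = 0)
    (hBLspan : ∀ v : ι → ℝ, (∀ l, d l < d l₀ → S l *ᵥ v = 0) → ∃ c : β → ℝ, BL *ᵥ c = v)
    (hCL : (BLᵀ * S l₀ * BL).IsHermitian) :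
    ∃ ε : ℝ, 0 < ε ∧ ∀ x : ℝ, 0 < x → x ≤ ε →
      Fintype.card {j // (Inertia.isHermitian_pencil d S hS x).eigenvalues j < 0}
        + Fintype.card {j // 0 < hCL.eigenvalues j} ≤ Fintype.card β := by
  classical
  set NL : Matrix ι ι ℝ := ∑ l ∈ Finset.univ.filter (fun l => d l < d l₀), S l with hNLdef
  obtain ⟨hNpsd, hNker⟩ := posSemidef_sum_filter S l₀ hpsd (fun l => d l < d l₀) (lt_irrefl _)
  have hNh : NL.IsHermitian := hNpsd.1
  have hNB : NL * BL = 0 := by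
    rw [hNLdef, Matrix.sum_mul]
    exact Finset.sum_eq_zero fun l hl => hBL l (Finset.mem_filter.1 hl).2
  obtain ⟨Y, hY, hfam⟩ := eventually_pos_family_oneRate NL (S l₀) 0 hNh BL hNB hCL
  refine ⟨min Y⁻¹ 1, lt_min (inv_pos.2 hY) one_pos, fun x hxpos hx => ?_⟩
  have hx1 : x ≤ 1 := le_trans hx (min_le_right _ _)
  have hxY : Y ≤ x⁻¹ := (le_inv_comm₀ hY hxpos).2 (le_trans hx (min_le_left _ _))
  set hF := Inertia.isHermitian_pencil d S hS x
  have hposF : ∀ c : ({i // 0 < hNh.eigenvalues i} ⊕ {j // 0 < hCL.eigenvalues j}) → ℝ, c ≠ 0 →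
      0 < (∑ k, c k • Sum.elim (fun i : {i // 0 < hNh.eigenvalues i} => (hNh.eigenvectorBasis i.1).ofLp)
            (fun j : {j // 0 < hCL.eigenvalues j} => BL *ᵥ (hCL.eigenvectorBasis j.1).ofLp) k) ⬝ᵥ
          ((∑ l, x ^ d l • S l) *ᵥ ∑ k, c k • Sum.elim (fun i : {i // 0 < hNh.eigenvalues i} => (hNh.eigenvectorBasis i.1).ofLp)
            (fun j : {j // 0 < hCL.eigenvalues j} => BL *ᵥ (hCL.eigenvectorBasis j.1).ofLp) k) := by
    intro c hc
    have h := hfam x⁻¹ hxY c hc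
    rw [smul_zero, sub_zero] at h
    have hcmp := univ_form_ge_small d S l₀ hpsd hd hxpos hx1
      (∑ k, c k • Sum.elim (fun i : {i // 0 < hNh.eigenvalues i} => (hNh.eigenvectorBasis i.1).ofLp)
        (fun j : {j // 0 < hCL.eigenvalues j} => BL *ᵥ (hCL.eigenvectorBasis j.1).ofLp) k)
    have hform : ∀ v : ι → ℝ, v ⬝ᵥ ((x⁻¹ • NL + S l₀) *ᵥ v) = v ⬝ᵥ (S l₀ *ᵥ v) + x⁻¹ * (v ⬝ᵥ (NL *ᵥ v)) := by
      intro v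
      simp only [Matrix.add_mulVec, Matrix.smul_mulVec, dotProduct_add, dotProduct_smul, smul_eq_mul]
      ring
    rw [hform] at h
    exact lt_of_lt_of_le (mul_pos (pow_pos hxpos _) h) hcmp
  have hcount := Inertia.card_le_posIndex hF _ hposF
  rw [Fintype.card_sum] at hcount
  have hidx := (Inertia.negIndex_add_posIndex_add_corank hF).1
  have hspan := card_le_posIndex_add_card_of_ker_subset_range hNpsd hNh BL
    (fun v hv => hBLspan v (hNker v hv))
  omega

/-- **LOWER END, lower bound.**  Any `B_L` killed by the lower letters ⇒ `ν(C_L) ≤ ν(F(x))` for all small `x > 0`. [folklore] -/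
theorem univ_eventually_negIndex_ge_small (d : κ → ℕ) (S : κ → Matrix ι ι ℝ) (hS : ∀ l, (S l).IsSymm) (l₀ : κ)
    (hpsd : ∀ l, l ≠ l₀ → (S l).PosSemidef) (hd : ∀ l, l ≠ l₀ → d l ≠ d l₀)
    {β : Type} [Fintype β] [DecidableEq β] (BL : Matrix ι β ℝ) (hBL : ∀ l, d l < d l₀ → S l * BL = 0)
    (hCL : (BLᵀ * S l₀ * BL).IsHermitian) :
    ∃ ε : ℝ, 0 < ε ∧ ∀ x : ℝ, 0 < x → x ≤ ε →
      Fintype.card {j // hCL.eigenvalues j < 0}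
        ≤ Fintype.card {j // (Inertia.isHermitian_pencil d S hS x).eigenvalues j < 0} := by
  classical
  set PU : Matrix ι ι ℝ := ∑ l ∈ Finset.univ.filter (fun l => d l₀ < d l), S l with hPUdef
  have h0h : (0 : Matrix β β ℝ).IsHermitian := Matrix.isHermitian_zero
  have hCn : (-(BLᵀ * S l₀ * BL)).IsHermitian := hCL.neg
  have hC1 : ((1 : Matrix β β ℝ)ᵀ * (-(BLᵀ * S l₀ * BL)) * 1).IsHermitian := by
    rw [Matrix.transpose_one, Matrix.one_mul, Matrix.mul_one]; exact hCn
  obtain ⟨Y, hY, hfam⟩ := eventually_pos_family_oneRate (0 : Matrix β β ℝ) (-(BLᵀ * S l₀ * BL)) (BLᵀ * PU * BL) h0h 1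
    (Matrix.zero_mul _) hC1
  refine ⟨min Y⁻¹ 1, lt_min (inv_pos.2 hY) one_pos, fun x hxpos hx => ?_⟩
  have hx1 : x ≤ 1 := le_trans hx (min_le_right _ _)
  have hxY : Y ≤ x⁻¹ := (le_inv_comm₀ hY hxpos).2 (le_trans hx (min_le_left _ _))
  set hF := Inertia.isHermitian_pencil d S hS x
  set fam := fun k : ({i // 0 < h0h.eigenvalues i} ⊕ {j // 0 < hC1.eigenvalues j}) =>
    Sum.elim (fun i : {i // 0 < h0h.eigenvalues i} => (h0h.eigenvectorBasis i.1).ofLp)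
      (fun j : {j // 0 < hC1.eigenvalues j} => (1 : Matrix β β ℝ) *ᵥ (hC1.eigenvectorBasis j.1).ofLp) k with hfamdef
  have hnegF : ∀ c : ({i // 0 < h0h.eigenvalues i} ⊕ {j // 0 < hC1.eigenvalues j}) → ℝ, c ≠ 0 →
      (∑ k, c k • (BL *ᵥ fam k)) ⬝ᵥ ((∑ l, x ^ d l • S l) *ᵥ ∑ k, c k • (BL *ᵥ fam k)) < 0 := by
    intro c hc
    have h := hfam x⁻¹ hxY c hc
    rw [inv_inv] at h
    set z : β → ℝ := ∑ k, c k • fam k with hz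
    have hcomb : ∑ k, c k • (BL *ᵥ fam k) = BL *ᵥ z := by rw [hz]; exact sum_smul_mulVec BL _ c
    rw [hcomb]
    have hker : ∀ l, d l < d l₀ → S l *ᵥ (BL *ᵥ z) = 0 := fun l hl => by
      rw [Matrix.mulVec_mulVec, hBL l hl, Matrix.zero_mulVec]
    have hcmp := univ_form_le_small_of_kernel d S l₀ hpsd hd hxpos hx1 (BL *ᵥ z) hker
    have hform : z ⬝ᵥ ((x⁻¹ • (0 : Matrix β β ℝ) + -(BLᵀ * S l₀ * BL) - x • (BLᵀ * PU * BL)) *ᵥ z)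
        = -((BL *ᵥ z) ⬝ᵥ (S l₀ *ᵥ (BL *ᵥ z)) + x * ((BL *ᵥ z) ⬝ᵥ (PU *ᵥ (BL *ᵥ z)))) := by
      rw [form_mulVec_eq (S l₀) BL z, form_mulVec_eq PU BL z]
      simp only [smul_zero, zero_add, Matrix.sub_mulVec, Matrix.neg_mulVec, Matrix.smul_mulVec, dotProduct_sub,
        dotProduct_neg, dotProduct_smul, smul_eq_mul]
      ring
    rw [hform] at h
    have hneg : (BL *ᵥ z) ⬝ᵥ (S l₀ *ᵥ (BL *ᵥ z)) + x * ((BL *ᵥ z) ⬝ᵥ (PU *ᵥ (BL *ᵥ z))) < 0 := by linarith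
    exact lt_of_le_of_lt hcmp (mul_neg_of_pos_of_neg (pow_pos hxpos _) hneg)
  have hcount := Inertia.card_le_negIndex hF _ hnegF
  rw [Fintype.card_sum] at hcount
  have hπ : Fintype.card {j // 0 < hC1.eigenvalues j} = Fintype.card {j // hCL.eigenvalues j < 0} := by
    rw [Inertia.posIndex_congr hC1 hCn (by rw [Matrix.transpose_one, Matrix.one_mul, Matrix.mul_one])]
    have hCnn : (-(-(BLᵀ * S l₀ * BL))).IsHermitian := hCn.neg
    have h1 := negIndex_neg_eq_posIndex hCn hCnn
    rw [Inertia.negIndex_congr hCnn hCL (neg_neg _)] at h1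
    exact h1.symm
  omega

end UniversalEnds

end GramDual

end Summit.ValiantsHypothesis.ValiantsHypothesis.Theorems.LacunarySymmetroidMatrixDescartes
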